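import Summits.ResolutionOfSingularities.ResolutionOfSingularities.Theses.UniformComplexity
import Summits.ResolutionOfSingularities.ResolutionOfSingularities.Theses.UniversalCells
import Summits.ResolutionOfSingularities.ResolutionOfSingularities.Theorems.UniformComplexityPrimeModelTransferStubTowerFromPerfectBase
import Summits.ResolutionOfSingularities.ResolutionOfSingularities.Theorems.UniformComplexityPrimeModelTransferStubDescentToPerfectExtensions
import Summits.ResolutionOfSingularities.ResolutionOfSingularities.Theorems.UniversalCellsPrimeFieldToPerfectStubClimbAlgebraic
import Summits.ResolutionOfSingularities.ResolutionOfSingularities.Theorems.UniversalCellsPrimeFieldToPerfectClimbOfRatFuncPerf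
import Mathlib.FieldTheory.IsAlgClosed.AlgebraicClosure
import Mathlib.FieldTheory.Finite.Basic
import Mathlib.RingTheory.Finiteness.Cardinality
import HarnessLib

/-!
# Crux `PrimeModelTransfer` (stmt-ResolutionOfSingularities-8933) from the shared kernel `ClimbRatFuncPerf` alone

Route `ResolutionOfSingularities/UniformComplexity`, crux `PrimeModelTransfer` (`𝔽_p`-bar ⇒ every
algebraically closed field of characteristic `p`), registered line `shared_climb_kernel`
(`Cruxes/PrimeModelTransfer/Lines/shared_climb_kernel.lean`, strategist r1, 2026-08-17). Of its
three registered stubs, two are now theorems of the tree: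

* `Theorems.PrimeModelTransfer.stub_towerFromPerfectBase`
  (Theorems/UniformComplexityPrimeModelTransferStubTowerFromPerfectBase.lean): a perfect base `k₀`
  with resolution + the one-transcendental climb ⇒ resolution over `perfectClosure k₀(s) E`;
* `Theorems.PrimeModelTransfer.stub_descentToPerfectExtensions`
  (Theorems/UniformComplexityPrimeModelTransferStubDescentToPerfectExtensions.lean): resolution over
  all `perfectClosure k₀(s) E` ⇒ resolution over the perfect `E`;

and the third, `stub_climbRatFuncPerf`, is VERBATIM the one open registered stub of the sibling crux
`UniversalCells.PrimeFieldToPerfect` (stmt-ResolutionOfSingularities-15233, RESHAPE 4) — the shared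
transfer KERNEL: for every prime `p` and every PERFECT field `M` of characteristic `p` over which all
integral separated finite-type schemes have resolutions, all integral separated finite-type schemes
over every perfect field `L` purely inseparable over `RatFunc M` (i.e. `L ≅ M(t)^{perf}`) have
resolutions.

This file records, importably and sorry-free, the consequence: **`PrimeModelTransfer` follows from
the kernel alone** (`primeModelTransfer_of_climbRatFuncPerf`), exactly as
`Theorems.PrimeFieldToPerfect.primeFieldToPerfect_of_climbRatFuncPerf` (p158667) records for the
sibling crux. Together: BOTH transfer cruxes of the prime-field / prime-model lever
(`UniversalCells.PrimeFieldToPerfect`, `UniformComplexity.PrimeModelTransfer`) reduce to ONE named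
statement, which the summit implies (`Theorems.PrimeFieldToPerfect.climbRatFuncPerf_of_resolutionOfSingularities`).
Also recorded: the elementary comparison of the two doors — given resolution over the prime field
(`UniversalCells.PrimeFieldThesis`), `PrimeFieldToPerfect` implies `PrimeModelTransfer`
(`primeModelTransfer_of_primeFieldToPerfect`), since an algebraically closed field is perfect and an
integral scheme is reduced. No new mathematics is claimed.

[OURS · LADDER-RESOLUTION L1, slot W8.2, kill test K8.2] Glue over the summit's own routes; it is NOT
a statement of, and attributes nothing to, Hironaka's 2017 manuscript.
-/

noncomputable section

set_option linter.dupNamespace false -- mandated namespace of this single-conjunct summit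

open CategoryTheory CategoryTheory.Limits AlgebraicGeometry TopologicalSpace
open Literature.AlgebraicGeometry.Resolution

namespace Summit.ResolutionOfSingularities.ResolutionOfSingularities.Theorems.PrimeModelTransfer

/-- **`𝔽_p`-bar satisfies the crux's algebraicity clause**: every `x ∈ AlgebraicClosure (ZMod p)`
satisfies `x ^ p ^ n = x` for some `n ≥ 1` (`𝔽_p(x)` is a finite field of cardinality `p ^ n`).
(Copy of the skeleton's glue lemma `algebraicClosure_zmod_pow_eq_self`.) [folklore] -/
theorem algebraicClosure_zmod_pow_eq_self (p : ℕ) [Fact p.Prime] (x : AlgebraicClosure (ZMod p)) :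
    ∃ n : ℕ, 0 < n ∧ x ^ p ^ n = x := by
  classical
  let F : IntermediateField (ZMod p) (AlgebraicClosure (ZMod p)) :=
    IntermediateField.adjoin (ZMod p) ({x} : Set (AlgebraicClosure (ZMod p)))
  have hx : IsIntegral (ZMod p) x := (Algebra.IsAlgebraic.isAlgebraic x).isIntegral
  haveI : FiniteDimensional (ZMod p) F := IntermediateField.adjoin.finiteDimensional hx
  haveI : Finite F := Module.finite_of_finite (ZMod p)
  letI : Fintype F := Fintype.ofFinite F
  obtain ⟨n, -, hn⟩ := FiniteField.card F p
  refine ⟨n, n.pos, ?_⟩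
  have hmem : x ∈ F := IntermediateField.mem_adjoin_simple_self (ZMod p) x
  have key : (⟨x, hmem⟩ : F) ^ p ^ (n : ℕ) = ⟨x, hmem⟩ := by
    rw [← hn]
    exact FiniteField.pow_card _
  have := congrArg (fun y : F => (y : AlgebraicClosure (ZMod p))) key
  simpa using this

/-- **`PrimeModelTransfer` from the kernel `ClimbRatFuncPerf`.** If, for every prime `p` and every
perfect field `M` of characteristic `p` with resolution of all integral separated finite-type
`M`-schemes, resolution holds for all integral separated finite-type schemes over every perfect field
`L` purely inseparable over `RatFunc M` (the registered stub `stub_climbRatFuncPerf`, shared by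
stmt-15233 and stmt-8933, verbatim as hypothesis) — then `UniformComplexity.PrimeModelTransfer`
holds. Chain, all by tree names: fix an algebraically closed `K` of characteristic `p`;
`k₀ := AlgebraicClosure (ZMod p)` is perfect and algebraic over `𝔽_p`
(`algebraicClosure_zmod_pow_eq_self`), so the crux hypothesis gives resolution over `k₀`, and
`K ⊇ k₀` (`IsAlgClosed.lift`); kernel ⇒ transcendental climb
(`PrimeFieldToPerfect.climbTranscendental_of_climbRatFuncPerf`) ⇒ with the algebraic case
(`PrimeFieldToPerfect.stub_climbAlgebraic`) the full one-transcendental climb ⇒ resolution over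
every `perfectClosure k₀(s) K` (`stub_towerFromPerfectBase`) ⇒ over `K`
(`stub_descentToPerfectExtensions`). [folklore] -/
theorem primeModelTransfer_of_climbRatFuncPerf
    (hR : ∀ p : ℕ, p.Prime → ∀ (M : Type) [Field M] [CharP M p] [PerfectField M],
      (∀ (X : Scheme.{0}) (f : X ⟶ Spec (.of M)), IsSeparated f → LocallyOfFiniteType f →
        QuasiCompact f → IsIntegral X → Scheme.HasResolution X) →
      ∀ (L : Type) [Field L] [PerfectField L] [Algebra (RatFunc M) L]
        [IsPurelyInseparable (RatFunc M) L]
        (X : Scheme.{0}) (f : X ⟶ Spec (.of L)), IsSeparated f → LocallyOfFiniteType f →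
          QuasiCompact f → IsIntegral X → Scheme.HasResolution X) :
    Summit.ResolutionOfSingularities.ResolutionOfSingularities.Theses.UniformComplexity.PrimeModelTransfer := by
  intro p hp hA K _ _ _ X f hs hl hq hX
  haveI : Fact p.Prime := ⟨hp⟩
  -- the one-transcendental climb over a perfect constant field, by cases on `t`
  have hClimb : ∀ (M : Type) [Field M] [CharP M p] [PerfectField M],
      (∀ (X : Scheme.{0}) (f : X ⟶ Spec (.of M)), IsSeparated f → LocallyOfFiniteType f →
        QuasiCompact f → IsIntegral X → Scheme.HasResolution X) →
      ∀ (L : Type) [Field L] [CharP L p] [PerfectField L] [Algebra M L] (t : L),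
        Algebra.IsAlgebraic (IntermediateField.adjoin M ({t} : Set L)) L →
        ∀ (X : Scheme.{0}) (f : X ⟶ Spec (.of L)), IsSeparated f → LocallyOfFiniteType f →
          QuasiCompact f → IsIntegral X → Scheme.HasResolution X := by
    intro M _ _ _ hM L _ _ _ _ t ht Y g hs' hl' hq' hY
    by_cases htr : Transcendental M t
    · exact PrimeFieldToPerfect.climbTranscendental_of_climbRatFuncPerf hR p hp M hM L t htr ht Y g
        hs' hl' hq' hY
    · -- `t` algebraic: `M⟮t⟯/M` is finite, `L/M⟮t⟯` algebraic, so `L/M` is algebraic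
      have halg : IsAlgebraic M t := Classical.not_not.mp htr
      haveI : FiniteDimensional M (IntermediateField.adjoin M ({t} : Set L)) :=
        IntermediateField.adjoin.finiteDimensional halg.isIntegral
      haveI : Algebra.IsAlgebraic M (IntermediateField.adjoin M ({t} : Set L)) :=
        Algebra.IsAlgebraic.of_finite M _
      haveI : Algebra.IsAlgebraic (IntermediateField.adjoin M ({t} : Set L)) L := ht
      haveI : Algebra.IsAlgebraic M L :=
        Algebra.IsAlgebraic.trans M (IntermediateField.adjoin M ({t} : Set L)) L
      exact PrimeFieldToPerfect.stub_climbAlgebraic M hM L Y g hs' hl' hq' hY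
  -- the prime model `k₀ = 𝔽_p`-bar: perfect, algebraic over `𝔽_p`, hence resolvable by hypothesis
  let k₀ : Type := AlgebraicClosure (ZMod p)
  haveI : CharP k₀ p := charP_of_injective_algebraMap (algebraMap (ZMod p) k₀).injective p
  have h₀ : ∀ (Y : Scheme.{0}) (g : Y ⟶ Spec (.of k₀)), IsSeparated g → LocallyOfFiniteType g →
      QuasiCompact g → IsIntegral Y → Scheme.HasResolution Y := fun Y g hs' hl' hq' hY =>
    hA k₀ (algebraicClosure_zmod_pow_eq_self p) Y g hs' hl' hq' hY
  -- `K ⊇ k₀`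
  letI : Algebra (ZMod p) K := ZMod.algebra K p
  let ι : k₀ →ₐ[ZMod p] K := IsAlgClosed.lift
  letI : Algebra k₀ K := ι.toRingHom.toAlgebra
  -- tower over every `perfectClosure k₀(s) K`, then descent to `K`
  refine stub_descentToPerfectExtensions k₀ K (fun s Y g hs' hl' hq' hY => ?_) X f hs hl hq hX
  exact stub_towerFromPerfectBase p hp k₀ h₀ (fun M _ _ _ hM L _ _ _ _ t ht => hClimb M hM L t ht)
    K s Y g hs' hl' hq' hY

/-- **Comparison of the two doors of the lever.** Given resolution over the prime field `𝔽_p`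
(`UniversalCells.PrimeFieldThesis`), the UniversalCells transfer crux `PrimeFieldToPerfect`
(`𝔽_p` ⇒ all perfect fields) implies the UniformComplexity transfer crux `PrimeModelTransfer`
(`𝔽_p`-bar ⇒ all algebraically closed fields), with the latter's own hypothesis left idle: an
algebraically closed field of characteristic `p` is perfect, and an integral scheme is reduced.
[folklore] -/
theorem primeModelTransfer_of_primeFieldToPerfect
    (hT : Summit.ResolutionOfSingularities.ResolutionOfSingularities.Theses.UniversalCells.PrimeFieldThesis)
    (hP : Summit.ResolutionOfSingularities.ResolutionOfSingularities.Theses.UniversalCells.PrimeFieldToPerfect) :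
    Summit.ResolutionOfSingularities.ResolutionOfSingularities.Theses.UniformComplexity.PrimeModelTransfer := by
  intro p hp _ K _ _ _ X f hs hl hq hX
  haveI : IsReduced X := inferInstance
  exact hP p hp (hT p hp) K X f hs hl hq inferInstance

end Summit.ResolutionOfSingularities.ResolutionOfSingularities.Theorems.PrimeModelTransfer

end
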